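import Summits.HodgeConjecture.HodgeConjecture.Theorems.Ring2AbelianAllAndreFibreClassRankOneInvariants
import Mathlib.Tactic.Module
import HarnessLib

/-!
# Ring 2 · sub-cell AbelianAll (ALL ABELIAN VARIETIES), André axis, part XVI-f — ONE CYCLE IN GENERAL POSITION
# SUFFICES IN THE PRESENCE OF A SYMMETRY: if an algebraicity-preserving endomorphism `T` of `H²ᵖ(𝒳)` restricts
# on the fibre to an operator with three distinct eigenvalues on a spanning eigen-triple of `I_{2p}(t₀)`, then a
# single algebraic class whose restriction has all three eigen-components non-zero gives (N_p)(t₀) — the W₆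
# find-the-cycle problem in its barest kernel form: ONE codimension-3 cycle with non-zero Weil components

HONEST FRAMING (page 1, verbatim): **research route, not a corollary; conditional on HC_CM plus one named
minimal statement.** Cell line: research route conditional on HC_CM; not a corollary; Q11.4-sentence-2
already refuted in dim ≥ 3. Nothing in this file proves a case of the Hodge conjecture for an abelian variety.
`HC_CM` = `Theses.RankFourFaces.CMAbelianHodge` does not occur in this file; item `Theses.RankFourFaces.CMToAbelian`
(stmt-16267) OPEN and not closed here. Seat `pub-hodge-ring2-ab-andre-2`, gen 8; kernel form of the "print-level
sharpening" of RING2-MAP AA2.59 (there: "not kernel: the habitat (W_E)₃ carries no global `K`-action" — here the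
symmetry is an explicit BINDER, any algebraicity-preserving `T` intertwining with a fibre operator `E`).

## What is proved (theorems only; no definition, no named fact, no sorry)

* `mem_of_eigenTriple` — LINEAR ALGEBRA (Lagrange interpolation / Vandermonde for three nodes): in a module over a
  field, if `E vᵢ = λᵢ vᵢ` (`i = 0, 1, 2`, `λᵢ` pairwise distinct), `z = Σ cᵢ vᵢ` with all `cᵢ ≠ 0`, and a submodule
  `M` contains `z`, `E z`, `E (E z)`, then `M` contains `v₀, v₁, v₂` (`(E - λ₁)(E - λ₂) z = c₀(λ₀-λ₁)(λ₀-λ₂) v₀`, …).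
* **`algebraicInvariantClassesAt_of_symmetry_of_eigenTriple`** — on a compact pencil `f : 𝒳 ⟶ S` of abelian
  `d`-folds, let `T : H²ᵖ(𝒳) → H²ᵖ(𝒳)` be `ℂ`-linear, PRESERVE ALGEBRAIC CLASSES (`T(Nᵖ) ⊆ Nᵖ`; e.g. `T = e^*` for an
  automorphism or a flat endomorphism `e` of `𝒳`, or any algebraic correspondence composed with such), and INTERTWINE
  with an operator `E` of `H²ᵖ(𝒳_{t₀})` (`j_{t₀}^* ∘ T = E ∘ j_{t₀}^*`; e.g. `E = (e|_{𝒳_{t₀}})^*`). If `I_{2p}(t₀)` is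
  spanned by three eigenvectors `v₀, v₁, v₂` of `E` with pairwise distinct eigenvalues, and ONE algebraic class
  `Z ∈ Nᵖ H²ᵖ(𝒳)` restricts to `Σ cᵢ vᵢ` with all `cᵢ ≠ 0`, then (N_p)(t₀): the restrictions of `Z`, `T Z`, `T² Z`
  span `I_{2p}(t₀)`.
* **`fibreClassLefschetzOn_relDim_six_of_symmetry_of_eigenTriple`** — the W₆ habitat form: a compact pencil of abelian
  SIXFOLDS with rank-one invariants in degrees 2 and 4 (part XV-e binders: `I₂ = ℂθ`, `I₄ = ℂθ²`) and such a
  symmetry / eigen-triple / cycle in degree 6 satisfies (β′_f) OUTRIGHT (part XV-e).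

READING (RING2-MAP §AbelianAll gen 8). On a (W_E)₃ pencil the `K`-action of the Weil family is by endomorphisms over
`S`; for `α ∈ 𝒪_K` with `σ(α)⁶ ≠ σ̄(α)⁶` (e.g. `K = ℚ(i)`, `α = 1 + i`) the operator `E = [α]^*` on
`I₆ = ℂθ³ ⊕ (W_K ⊗ ℂ) = ℂθ³ ⊕ ℂw_σ ⊕ ℂw_σ̄` has the three distinct eigenvalues `Nm(α)³`, `σ(α)⁶`, `σ̄(α)⁶`, and a
RATIONAL class with non-zero `W_K`-component has both `w_σ`- and `w_σ̄`-components non-zero (they are conjugate).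
So, granted those print identifications as the binders of the theorem: **(β′_f) on the W₆ habitat ⟸ ONE codimension-3
algebraic cycle `Z` on the 7-fold `𝒳` whose restriction to one fibre is not in `ℚθ³ ⊕` (one eigenline)** — in
particular any `Z` with `j^*[Z] ∉ ℚθ³` rational. The cycle sought is one, not a basis. No named fact; `HC_CM` absent.

References: Andre1996Motifs (§5.2, §6.3 Lemme 6.3.1); Abdulali1994FamiliesAV (Thm. 5.5 p. 1130); vanGeemen1994HodgeAV
(4.9, Lemma 5.2, Thm. 6.12); DeligneMilne1982 (§4, Weil classes); VoisinHodgeI2002 (§11.3).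
-/

noncomputable section

set_option linter.dupNamespace false

namespace Summit.HodgeConjecture.HodgeConjecture.Ring2.AbelianAll

open CategoryTheory AlgebraicGeometry
open Literature.AlgebraicGeometry Literature.AlgebraicGeometry.Motives
open Literature.AlgebraicGeometry.HodgeTheory
open Literature.AlgebraicTopology.SingularHomology (singularCohomology)

/-! ## §1 Linear algebra: three eigenlines are recovered from one vector in general position -/

section LinearAlgebra

variable {V : Type*} [AddCommGroup V] [Module ℂ V]

/-- **Lagrange interpolation on three eigenlines.** If `E vᵢ = λᵢ vᵢ` for `i = 0, 1, 2` with pairwise distinct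
`λᵢ`, `z = c₀v₀ + c₁v₁ + c₂v₂` with all `cᵢ ≠ 0`, and a submodule `M` contains `z`, `E z` and `E (E z)`, then `M`
contains `v₀`, `v₁` and `v₂`: `E²z - (λⱼ+λₖ) E z + λⱼλₖ z = cᵢ(λᵢ-λⱼ)(λᵢ-λₖ) vᵢ` for `{i,j,k} = {0,1,2}` (the `3 × 3`
Vandermonde). [folklore] -/
theorem mem_of_eigenTriple (E : V →ₗ[ℂ] V) (v : Fin 3 → V) (μ c : Fin 3 → ℂ) (hv : ∀ i, E (v i) = μ i • v i)
    (hμ : Function.Injective μ) (hc : ∀ i, c i ≠ 0) (M : Submodule ℂ V) {z : V}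
    (hz : z = c 0 • v 0 + c 1 • v 1 + c 2 • v 2) (h0 : z ∈ M) (h1 : E z ∈ M) (h2 : E (E z) ∈ M) :
    ∀ i, v i ∈ M := by
  have hEz : E z = (c 0 * μ 0) • v 0 + (c 1 * μ 1) • v 1 + (c 2 * μ 2) • v 2 := by
    rw [hz]; simp only [map_add, map_smul, hv, smul_smul]
  have hEEz : E (E z) = (c 0 * μ 0 * μ 0) • v 0 + (c 1 * μ 1 * μ 1) • v 1 + (c 2 * μ 2 * μ 2) • v 2 := by
    rw [hEz]; simp only [map_add, map_smul, hv, smul_smul]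
  have hne : ∀ i j : Fin 3, i ≠ j → μ i - μ j ≠ 0 := fun i j hij ↦ sub_ne_zero.2 fun h ↦ hij (hμ h)
  -- the three Lagrange combinations
  have hL : ∀ a b : ℂ, E (E z) - a • E z + b • z ∈ M := fun a b ↦
    M.add_mem (M.sub_mem h2 (M.smul_mem a h1)) (M.smul_mem b h0)
  have k0 : E (E z) - (μ 1 + μ 2) • E z + (μ 1 * μ 2) • z = (c 0 * (μ 0 - μ 1) * (μ 0 - μ 2)) • v 0 := by
    rw [hEEz, hEz, hz]; module
  have k1 : E (E z) - (μ 0 + μ 2) • E z + (μ 0 * μ 2) • z = (c 1 * (μ 1 - μ 0) * (μ 1 - μ 2)) • v 1 := by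
    rw [hEEz, hEz, hz]; module
  have k2 : E (E z) - (μ 0 + μ 1) • E z + (μ 0 * μ 1) • z = (c 2 * (μ 2 - μ 0) * (μ 2 - μ 1)) • v 2 := by
    rw [hEEz, hEz, hz]; module
  have key : ∀ (i : Fin 3) (s : ℂ), s ≠ 0 → s • v i ∈ M → v i ∈ M := fun i s hs h ↦ by
    have := M.smul_mem s⁻¹ h
    rwa [smul_smul, inv_mul_cancel₀ hs, one_smul] at this
  intro i
  fin_cases i
  · exact key 0 _ (mul_ne_zero (mul_ne_zero (hc 0) (hne 0 1 (by decide))) (hne 0 2 (by decide))) (k0 ▸ hL _ _)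
  · exact key 1 _ (mul_ne_zero (mul_ne_zero (hc 1) (hne 1 0 (by decide))) (hne 1 2 (by decide))) (k1 ▸ hL _ _)
  · exact key 2 _ (mul_ne_zero (mul_ne_zero (hc 2) (hne 2 0 (by decide))) (hne 2 1 (by decide))) (k2 ▸ hL _ _)

end LinearAlgebra

variable {𝒳 S : SchemeOver ℂ}

/-! ## §2 (N_p)(t₀) from one algebraic class in general position and a symmetry -/

/-- **One cycle in general position plus an algebraicity-preserving symmetry gives (N_p)(t₀).** Let
`f : 𝒳 ⟶ S` be a compact pencil of abelian `d`-folds, `T` a `ℂ`-linear endomorphism of `H²ᵖ(𝒳(ℂ); ℂ)` mapping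
algebraic classes to algebraic classes (`e^*` for an automorphism / flat endomorphism `e` of `𝒳` over `S`, an
algebraic correspondence, …) and intertwining through `j_{t₀}^*` with an operator `E` of `H²ᵖ(𝒳_{t₀}(ℂ); ℂ)`.
Suppose `I_{2p}(t₀) = j_{t₀}^* H²ᵖ(𝒳)` is contained in the span of three eigenvectors `v₀, v₁, v₂` of `E` with
pairwise distinct eigenvalues, and some ALGEBRAIC `Z ∈ Nᵖ H²ᵖ(𝒳)` has `j_{t₀}^* Z = Σ cᵢ vᵢ` with all `cᵢ ≠ 0`.
Then every class of `I_{2p}(t₀)` is the restriction of an algebraic class (a combination of `Z`, `TZ`, `T²Z`):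
(N_p f)(t₀). [cite: Abdulali1994FamiliesAV, Theorem 5.5 (p. 1130)] [cite: vanGeemen1994HodgeAV, Lemma 5.2 and 6.12] -/
theorem algebraicInvariantClassesAt_of_symmetry_of_eigenTriple {d : ℕ} {f : 𝒳 ⟶ S}
    (hf : IsCompactAbelianPencil f d) (t₀ : ComplexPoints S) (p : ℕ)
    (T : complexBetti 𝒳 (2 * p) →ₗ[ℂ] complexBetti 𝒳 (2 * p))
    (hT : ∀ Z ∈ algebraicClasses 𝒳 p, T Z ∈ algebraicClasses 𝒳 p)
    (E : complexBetti (fiberOver f t₀) (2 * p) →ₗ[ℂ] complexBetti (fiberOver f t₀) (2 * p))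
    (hTE : ∀ W : complexBetti 𝒳 (2 * p),
      complexBetti.map (fiberι f t₀) (2 * p) (T W) = E (complexBetti.map (fiberι f t₀) (2 * p) W))
    (v : Fin 3 → complexBetti (fiberOver f t₀) (2 * p)) (μ : Fin 3 → ℂ) (hv : ∀ i, E (v i) = μ i • v i)
    (hμ : Function.Injective μ)
    (hspan : ∀ W : complexBetti 𝒳 (2 * p),
      complexBetti.map (fiberι f t₀) (2 * p) W ∈ Submodule.span ℂ (Set.range v))
    {Z : complexBetti 𝒳 (2 * p)} (hZ : Z ∈ algebraicClasses 𝒳 p) (c : Fin 3 → ℂ) (hc : ∀ i, c i ≠ 0)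
    (hz : complexBetti.map (fiberι f t₀) (2 * p) Z = c 0 • v 0 + c 1 • v 1 + c 2 • v 2) :
    AlgebraicInvariantClassesAt hf t₀ p := by
  -- the fibre classes which are restrictions of algebraic classes
  let M : Submodule ℂ (complexBetti (fiberOver f t₀) (2 * p)) :=
    { carrier := {y | ∃ A ∈ algebraicClasses 𝒳 p, complexBetti.map (fiberι f t₀) (2 * p) A = y}
      zero_mem' := ⟨0, Submodule.zero_mem _, by rw [map_zero]⟩
      add_mem' := by
        rintro y₁ y₂ ⟨A₁, hA₁, rfl⟩ ⟨A₂, hA₂, rfl⟩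
        exact ⟨A₁ + A₂, Submodule.add_mem _ hA₁ hA₂, by rw [map_add]⟩
      smul_mem' := by
        rintro a y ⟨A, hA, rfl⟩
        exact ⟨a • A, Submodule.smul_mem _ a hA, by rw [map_smul]⟩ }
  have h0 : complexBetti.map (fiberι f t₀) (2 * p) Z ∈ M := ⟨Z, hZ, rfl⟩
  have h1 : E (complexBetti.map (fiberι f t₀) (2 * p) Z) ∈ M := ⟨T Z, hT Z hZ, hTE Z⟩
  have h2 : E (E (complexBetti.map (fiberι f t₀) (2 * p) Z)) ∈ M :=
    ⟨T (T Z), hT _ (hT Z hZ), by rw [hTE, hTE]⟩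
  have hvM : ∀ i, v i ∈ M := mem_of_eigenTriple E v μ c hv hμ hc M hz h0 h1 h2
  have hle : Submodule.span ℂ (Set.range v) ≤ M := Submodule.span_le.2 (by rintro _ ⟨i, rfl⟩; exact hvM i)
  intro W
  obtain ⟨A, hA, hAW⟩ := hle (hspan W)
  exact ⟨A, hA, hAW⟩

/-! ## §3 The W₆ habitat form -/

/-- **(β′_f) on a compact pencil of abelian SIXFOLDS with rank-one invariants in degrees 2, 4 and ONE codimension-3
cycle in general position for a symmetry with three eigenlines on `I₆(t₀)`** (parts XV-e + §2): the Weil habitat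
reading is in the module docstring — `I₆ = ℚθ³ ⊕ W_K`, `E = [α]^*` for `α ∈ 𝒪_K` with `σ(α)⁶ ≠ σ̄(α)⁶`, and the
hypothesis says ONE codimension-3 algebraic cycle of the 7-fold `𝒳` restricts with non-zero components on
`θ³`, `w_σ`, `w_σ̄`. [cite: Abdulali1994FamiliesAV, Conjecture 5.3 and Theorem 5.5 (p. 1130)] [cite: Andre1996Motifs, §6.3 Lemme 6.3.1]
[cite: vanGeemen1994HodgeAV, 4.9 and Thm. 6.12] -/
theorem fibreClassLefschetzOn_relDim_six_of_symmetry_of_eigenTriple {f : 𝒳 ⟶ S} (hf : IsCompactAbelianPencil f 6)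
    (t₀ : ComplexPoints S)
    (h2 : Module.finrank ℂ (LinearMap.range (complexBetti.map (fiberι f t₀) (2 * 1)).hom) = 1)
    (h4 : Module.finrank ℂ (LinearMap.range (complexBetti.map (fiberι f t₀) (2 * 2)).hom) = 1)
    (T : complexBetti 𝒳 (2 * 3) →ₗ[ℂ] complexBetti 𝒳 (2 * 3))
    (hT : ∀ Z ∈ algebraicClasses 𝒳 3, T Z ∈ algebraicClasses 𝒳 3)
    (E : complexBetti (fiberOver f t₀) (2 * 3) →ₗ[ℂ] complexBetti (fiberOver f t₀) (2 * 3))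
    (hTE : ∀ W : complexBetti 𝒳 (2 * 3),
      complexBetti.map (fiberι f t₀) (2 * 3) (T W) = E (complexBetti.map (fiberι f t₀) (2 * 3) W))
    (v : Fin 3 → complexBetti (fiberOver f t₀) (2 * 3)) (μ : Fin 3 → ℂ) (hv : ∀ i, E (v i) = μ i • v i)
    (hμ : Function.Injective μ)
    (hspan : ∀ W : complexBetti 𝒳 (2 * 3),
      complexBetti.map (fiberι f t₀) (2 * 3) W ∈ Submodule.span ℂ (Set.range v))
    {Z : complexBetti 𝒳 (2 * 3)} (hZ : Z ∈ algebraicClasses 𝒳 3) (c : Fin 3 → ℂ) (hc : ∀ i, c i ≠ 0)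
    (hz : complexBetti.map (fiberι f t₀) (2 * 3) Z = c 0 • v 0 + c 1 • v 1 + c 2 • v 2) :
    FibreClassLefschetzOn hf :=
  fibreClassLefschetzOn_relDim_six_of_rankOne_of_algebraicInvariantClassesAt_three hf t₀ h2 h4
    (algebraicInvariantClassesAt_of_symmetry_of_eigenTriple hf t₀ 3 T hT E hTE v μ hv hμ hspan hZ c hc hz)

end Summit.HodgeConjecture.HodgeConjecture.Ring2.AbelianAll

end
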